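import Mathlib
import Literature.NumberTheory.Transcendental.KZHyperbolicLadder
import Literature.NumberTheory.Transcendental.KZCalculusProofs
import Literature.NumberTheory.Transcendental.KZLogCalculusProofs
import Literature.NumberTheory.Transcendental.KZSemiCanonicalReductionProofs
import Literature.NumberTheory.Transcendental.KZDominatedFamilyRelations
import Summits.KontsevichZagierPeriods.KontsevichZagierPeriods.Theorems.HyperbolicBlochOffTetraSectorKernelLadderFamilyExists
import Summits.KontsevichZagierPeriods.KontsevichZagierPeriods.Theorems.HyperbolicBlochOffTetraSectorKernelRungZeroIntervals
import Summits.KontsevichZagierPeriods.KontsevichZagierPeriods.Theorems.HyperbolicBlochOffTetraSectorKernelStubVerticalCutsAux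

/-!
# `OffTetraSectorKernel` (stmt-KontsevichZagierPeriods-10557), line `odd-hyperbolic-ladder`:
# vertical cuts of a `ℚ̄`-geodesic polygon of `ℍ²`

Stub `stub_verticalCuts`. Rung `1` of the hyperbolic scissors ladder lives in the upper half-plane
`{p : Fin 2 → ℝ | 0 < p 1}` (`x = p 0`, `t = p 1`) with the area density `1/t²`. A finite-area
`ℚ̄`-geodesic polygon `P` is cut out of `{t > 0}` by finitely many constraints `0 < εᵢ gᵢ`, `gᵢ` a
vertical line `aᵢ x − cᵢ` or a semicircle `(x − aᵢ)² + t² − cᵢ` with real algebraic data.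

We cut `P` by the vertical geodesics through the finitely many (algebraic) BREAKPOINTS: the zeros
`cᵢ / aᵢ` of the affine constraints, the ends `aᵢ ± √cᵢ` of the semicircles and the abscissae of the
crossings of two semicircles. The vertical walls are Lebesgue-null, so by iterated domain
additivity (`KZ.of_sub_sum_of_mem_relations`, Kontsevich–Zagier's rule (1a)) the representation
`[P, t⁻²]` is, modulo the moves, the sum of its restrictions to the open strips between consecutive
breakpoints. On such a strip the signs of all constraints and the order of the semicircles are
constant (intermediate value theorem), so the strip structure theorem (`stub_stripStructure`, taken
as a hypothesis) says that `P` is there empty, one V-piece `{u < x < v, t > 0, (x − a)² + t² > c}`,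
or the region between two semicircles, which is the difference of two V-pieces up to a null arc
(rule (1a) again). Representations of the V-pieces are supplied by `stub_vPiece` (i) (hypothesis).

References: M. Kontsevich, D. Zagier, *Periods* (2001), §1.2 rule (1); A. B. Goncharov, *Volumes of
hyperbolic manifolds and mixed Tate motives* (1999), §1.1.
-/

noncomputable section

open Set MeasureTheory
open Literature.NumberTheory.Transcendental Literature.ModelTheory.ExponentialFields

namespace Summit.KontsevichZagierPeriods.HyperbolicBloch.OffTetraSectorKernel

/-! ## The vertical cuts -/

/-- **Vertical cuts** (rule (1a) of Kontsevich–Zagier): every representation of the area of a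
finite-area `ℚ̄`-geodesic polygon `P` of `ℍ²` is, modulo the moves, a signed sum of representations of
V-pieces `V α β a c = {α < x < β, t > 0, (x − a)² + t² > c}` with real algebraic data. Cut `P` by the
vertical geodesics through the breakpoints (zeros of the affine constraints, ends `aᵢ ± √cᵢ` of the
semicircles, crossings of two semicircles; the walls are null, `KZ.of_sub_sum_of_mem_relations`) and
read each strip off the strip structure theorem (`[between two semicircles] = [V] − [V]`, the
separating arc being null). The statements of `stub_stripStructure` and `stub_vPiece` (i) are taken
as hypotheses. [cite: KontsevichZagier2001, §1.2 rule (1)] -/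
theorem stub_verticalCuts :
    ∀ (V : ℝ → ℝ → ℝ → ℝ → Set (Fin 2 → ℝ)),
      (∀ α β a c, V α β a c = {p | α < p 0 ∧ p 0 < β ∧ 0 < p 1 ∧ c < (p 0 - a) ^ 2 + p 1 ^ 2}) →
    (∀ (k : ℕ) (flat : Fin k → Bool) (a c ε : Fin k → ℝ) (P : Set (Fin 2 → ℝ)),
      (∀ i, ε i = 1 ∨ ε i = -1) →
      P = {p | 0 < p 1 ∧ ∀ i, 0 < ε i * (if flat i then a i * p 0 - c i else (p 0 - a i) ^ 2 + p 1 ^ 2 - c i)} →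
      IntegrableOn (fun p : Fin 2 → ℝ => 1 / p 1 ^ 2) P →
      ∀ (J : Set ℝ), (∃ u v : ℝ, J = Ioo u v ∨ J = Ioi u ∨ J = Iio v) →
      (∀ i, flat i = true → (∀ x ∈ J, 0 < ε i * (a i * x - c i)) ∨ (∀ x ∈ J, ε i * (a i * x - c i) ≤ 0)) →
      (∀ i, flat i = false → (∀ x ∈ J, 0 < c i - (x - a i) ^ 2) ∨ (∀ x ∈ J, c i - (x - a i) ^ 2 ≤ 0)) →
      (∀ i j, flat i = false → flat j = false →
        (∀ x ∈ J, c i - (x - a i) ^ 2 ≤ c j - (x - a j) ^ 2) ∨ (∀ x ∈ J, c j - (x - a j) ^ 2 ≤ c i - (x - a i) ^ 2)) →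
      P ∩ {p | p 0 ∈ J} = ∅ ∨
      (∃ (u v : ℝ) (i : Fin k), J = Ioo u v ∧ flat i = false ∧ ε i = 1 ∧ (u - a i) ^ 2 ≤ c i ∧ (v - a i) ^ 2 ≤ c i ∧
        P ∩ {p | p 0 ∈ J} = {p | u < p 0 ∧ p 0 < v ∧ 0 < p 1 ∧ c i < (p 0 - a i) ^ 2 + p 1 ^ 2}) ∨
      (∃ (u v : ℝ) (i j : Fin k), J = Ioo u v ∧ flat i = false ∧ flat j = false ∧ ε i = 1 ∧ ε j = -1 ∧
        (u - a i) ^ 2 ≤ c i ∧ (v - a i) ^ 2 ≤ c i ∧ (u - a j) ^ 2 ≤ c j ∧ (v - a j) ^ 2 ≤ c j ∧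
        (∀ x ∈ Ioo u v, c i - (x - a i) ^ 2 ≤ c j - (x - a j) ^ 2) ∧
        P ∩ {p | p 0 ∈ J} = {p | u < p 0 ∧ p 0 < v ∧ 0 < p 1 ∧ c i < (p 0 - a i) ^ 2 + p 1 ^ 2 ∧
          (p 0 - a j) ^ 2 + p 1 ^ 2 < c j})) →
    (∀ α β a c : ℝ, IsAlgebraic ℚ α → IsAlgebraic ℚ β → IsAlgebraic ℚ a → IsAlgebraic ℚ c →
        α < β → (α - a) ^ 2 ≤ c → (β - a) ^ 2 ≤ c →
        ∃ r : KZ.IntegralRep 2, r.domain = V α β a c ∧ r.integrand = fun p => 1 / p 1 ^ 2) →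
    ∀ (P : Set (Fin 2 → ℝ)), KZ.IsGeodesicPolytope 1 P →
    ∀ (r : KZ.IntegralRep 2), r.domain = P → EqOn r.integrand (fun p => 1 / p 1 ^ 2) P →
      ∃ (m : ℕ) (α β a c : Fin m → ℝ) (s : Fin m → ℤ) (W : Fin m → KZ.IntegralRep 2),
        (∀ j, IsAlgebraic ℚ (α j) ∧ IsAlgebraic ℚ (β j) ∧ IsAlgebraic ℚ (a j) ∧ IsAlgebraic ℚ (c j) ∧
          α j < β j ∧ (α j - a j) ^ 2 ≤ c j ∧ (β j - a j) ^ 2 ≤ c j) ∧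
        (∀ j, (W j).domain = V (α j) (β j) (a j) (c j) ∧ (W j).integrand = fun p => 1 / p 1 ^ 2) ∧
        KZ.of r - ∑ j, s j • KZ.of (W j) ∈ KZ.relations := by
  classical
  intro V hV hStrip hRep P hP r hrdom hrint
  obtain ⟨k, flat, a, c, ε, ha, hc, hε, ha0, hPdef, hint⟩ := hP
  /- (1) the reduced data `a' i = a i 0` -/
  have hl : (Fin.last 1 : Fin 2) = 1 := rfl
  have ha1 : ∀ i, a i 1 = 0 := fun i => hl ▸ ha0 i
  obtain ⟨a', ha'def⟩ : ∃ a' : Fin k → ℝ, ∀ i, a' i = a i 0 := ⟨_, fun _ => rfl⟩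
  have ha' : ∀ i, IsAlgebraic ℚ (a' i) := fun i => (ha'def i).symm ▸ ha i 0
  have hPred : P = {p : Fin 2 → ℝ | 0 < p 1 ∧ ∀ i, 0 < ε i *
      (if flat i then a' i * p 0 - c i else (p 0 - a' i) ^ 2 + p 1 ^ 2 - c i)} := by
    rw [hPdef]
    ext p
    simp only [mem_setOf_eq, hl]
    refine and_congr_right fun _ => forall_congr' fun i => ?_
    rw [Fin.sum_univ_two, Fin.sum_univ_two, ha1, ha'def, zero_mul, add_zero, sub_zero]
  have hint' : IntegrableOn (fun p : Fin 2 → ℝ => 1 / p 1 ^ 2) P := by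
    have hd : KZ.hypDensity 1 = fun p : Fin 2 → ℝ => 1 / p 1 ^ 2 := by
      funext p
      simp [KZ.hypDensity, hl]
    simpa only [hd] using hint
  have hPsa : IsSemialgebraic ℚ P := hrdom ▸ r.isSemialgebraic_domain
  /- (2) the breakpoints -/
  obtain ⟨B, hBdef⟩ : ∃ B : Finset ℝ, B = insert 0 (Finset.univ.image (fun i => c i / a' i) ∪
      Finset.univ.image (fun i => a' i - Real.sqrt (c i)) ∪
      Finset.univ.image (fun i => a' i + Real.sqrt (c i)) ∪
      Finset.univ.image (fun ij : Fin k × Fin k =>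
        ((a' ij.2) ^ 2 - (a' ij.1) ^ 2 + c ij.1 - c ij.2) / (2 * (a' ij.2 - a' ij.1)))) := ⟨_, rfl⟩
  have hB0 : (0 : ℝ) ∈ B := hBdef ▸ Finset.mem_insert_self _ _
  have hBne : B.Nonempty := ⟨0, hB0⟩
  have hBdiv : ∀ i, c i / a' i ∈ B := fun i => by
    rw [hBdef]
    exact Finset.mem_insert_of_mem <| Finset.mem_union_left _ <| Finset.mem_union_left _ <|
      Finset.mem_union_left _ <| Finset.mem_image_of_mem _ (Finset.mem_univ i)
  have hBsub : ∀ i, a' i - Real.sqrt (c i) ∈ B := fun i => by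
    rw [hBdef]
    exact Finset.mem_insert_of_mem <| Finset.mem_union_left _ <| Finset.mem_union_left _ <|
      Finset.mem_union_right _ <| Finset.mem_image_of_mem _ (Finset.mem_univ i)
  have hBadd : ∀ i, a' i + Real.sqrt (c i) ∈ B := fun i => by
    rw [hBdef]
    exact Finset.mem_insert_of_mem <| Finset.mem_union_left _ <| Finset.mem_union_right _ <|
      Finset.mem_image_of_mem _ (Finset.mem_univ i)
  have hBcross : ∀ i j, ((a' j) ^ 2 - (a' i) ^ 2 + c i - c j) / (2 * (a' j - a' i)) ∈ B := by
    intro i j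
    rw [hBdef]
    exact Finset.mem_insert_of_mem <| Finset.mem_union_right _ <|
      Finset.mem_image.2 ⟨(i, j), Finset.mem_univ _, rfl⟩
  have hBalg : ∀ w ∈ B, IsAlgebraic ℚ w := by
    intro w hw
    rw [hBdef] at hw
    simp only [Finset.mem_insert, Finset.mem_union, Finset.mem_image, Finset.mem_univ, true_and,
      Prod.exists] at hw
    have h2 : IsAlgebraic ℚ (2 : ℝ) := isAlgebraic_nat 2
    rcases hw with rfl | ((⟨i, rfl⟩ | ⟨i, rfl⟩) | ⟨i, rfl⟩) | ⟨i, j, rfl⟩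
    · exact isAlgebraic_zero
    · rw [div_eq_mul_inv]; exact (hc i).mul (ha' i).inv
    · exact (ha' i).sub (rungZero_isAlgebraic_sqrt (hc i))
    · exact (ha' i).add (rungZero_isAlgebraic_sqrt (hc i))
    · rw [div_eq_mul_inv]
      exact (((((ha' j).pow 2).sub ((ha' i).pow 2)).add (hc i)).sub (hc j)).mul
        (h2.mul ((ha' j).sub (ha' i))).inv
  /- (3) on a breakpoint-free interval the hypotheses of the strip structure theorem hold -/
  have key : ∀ J : Set ℝ, IsPreconnected J → (∀ x ∈ J, x ∉ B) →
      (∀ i, flat i = true → (∀ x ∈ J, 0 < ε i * (a' i * x - c i)) ∨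
        (∀ x ∈ J, ε i * (a' i * x - c i) ≤ 0)) ∧
      (∀ i, flat i = false → (∀ x ∈ J, 0 < c i - (x - a' i) ^ 2) ∨
        (∀ x ∈ J, c i - (x - a' i) ^ 2 ≤ 0)) ∧
      (∀ i j, flat i = false → flat j = false →
        (∀ x ∈ J, c i - (x - a' i) ^ 2 ≤ c j - (x - a' j) ^ 2) ∨
        (∀ x ∈ J, c j - (x - a' j) ^ 2 ≤ c i - (x - a' i) ^ 2)) := by
    intro J hJ hJB
    refine ⟨fun i _ => vcut_affine_sign hJ _ _ _ fun x hx _ h =>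
        hJB x hx (by rw [h]; exact hBdiv i),
      fun i _ => vcut_circle_sign hJ _ _ (fun x hx h => hJB x hx (by rw [h]; exact hBsub i))
        (fun x hx h => hJB x hx (by rw [h]; exact hBadd i)),
      fun i j _ _ => vcut_circle_order hJ _ _ _ _ fun x hx _ h =>
        hJB x hx (by rw [h]; exact hBcross i j)⟩
  have hS' := fun (J : Set ℝ) (hsh : ∃ u v : ℝ, J = Ioo u v ∨ J = Ioi u ∨ J = Iio v)
      (hJ : IsPreconnected J) (hJB : ∀ x ∈ J, x ∉ B) =>
    hStrip k flat a' c ε P hε hPred hint' J hsh (key J hJ hJB).1 (key J hJ hJB).2.1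
      (key J hJ hJB).2.2
  /- (4) nothing of `P` lies left of the first or right of the last breakpoint -/
  have hlo : P ∩ {p | p 0 ∈ Iio (B.min' hBne)} = ∅ := by
    rcases hS' (Iio (B.min' hBne)) ⟨0, _, Or.inr (Or.inr rfl)⟩ isPreconnected_Iio
        (fun x hx hxB => not_le.2 (mem_Iio.1 hx) (B.min'_le x hxB)) with
      h | ⟨u, v, -, h, -⟩ | ⟨u, v, -, -, h, -⟩
    · exact h
    · exact absurd h (vcut_Iio_ne_Ioo _ _ _)
    · exact absurd h (vcut_Iio_ne_Ioo _ _ _)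
  have hhi : P ∩ {p | p 0 ∈ Ioi (B.max' hBne)} = ∅ := by
    rcases hS' (Ioi (B.max' hBne)) ⟨_, 0, Or.inr (Or.inl rfl)⟩ isPreconnected_Ioi
        (fun x hx hxB => not_le.2 (mem_Ioi.1 hx) (B.le_max' x hxB)) with
      h | ⟨u, v, -, h, -⟩ | ⟨u, v, -, -, h, -⟩
    · exact h
    · exact absurd h (vcut_Ioi_ne_Ioo _ _ _)
    · exact absurd h (vcut_Ioi_ne_Ioo _ _ _)
  /- (5) the strips between consecutive breakpoints and the restrictions of `r` to them -/
  obtain ⟨S, hSdef⟩ : ∃ S : Finset (ℝ × ℝ),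
      S = (B ×ˢ B).filter (fun q => q.1 < q.2 ∧ ∀ w ∈ B, w ≤ q.1 ∨ q.2 ≤ w) := ⟨_, rfl⟩
  have hmemS : ∀ q : ℝ × ℝ,
      q ∈ S ↔ (q.1 ∈ B ∧ q.2 ∈ B) ∧ q.1 < q.2 ∧ ∀ w ∈ B, w ≤ q.1 ∨ q.2 ≤ w := fun q => by
    rw [hSdef, Finset.mem_filter, Finset.mem_product]
  have hRex : ∀ q : S, ∃ Rq : KZ.IntegralRep 2,
      Rq.domain = P ∩ {p | p 0 ∈ Ioo q.1.1 q.1.2} ∧ Rq.integrand = r.integrand := fun q => by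
    obtain ⟨⟨huB, hvB⟩, -, -⟩ := (hmemS q.1).1 q.2
    exact ⟨r.restrict (P ∩ {p | p 0 ∈ Ioo q.1.1 q.1.2})
      (hPsa.inter (vcut_isSemialgebraic_strip (hBalg _ huB) (hBalg _ hvB)))
      (fun p hp => by rw [hrdom]; exact hp.1), rfl, rfl⟩
  choose R hRdom hRint using hRex
  /- (6) `[r] ≡ Σ_strips [r|strip]`: the strips are disjoint and cover `P` off the null walls -/
  have hcov : volume (r.domain \ ⋃ q ∈ (Finset.univ : Finset S), (R q).domain) = 0 := by
    refine measure_mono_null ?_ (vcut_volume_walls B)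
    intro p hp
    rw [hrdom] at hp
    obtain ⟨hpP, hpU⟩ := hp
    by_contra hpB
    change p 0 ∉ B at hpB
    have hlo' : B.min' hBne < p 0 := by
      refine lt_of_le_of_ne (not_lt.1 fun h => ?_)
        (fun h => hpB (by rw [← h]; exact B.min'_mem hBne))
      exact (eq_empty_iff_forall_notMem.1 hlo p) ⟨hpP, h⟩
    have hhi' : p 0 < B.max' hBne := by
      refine lt_of_le_of_ne (not_lt.1 fun h => ?_)
        (fun h => hpB (by rw [h]; exact B.max'_mem hBne))
      exact (eq_empty_iff_forall_notMem.1 hhi p) ⟨hpP, h⟩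
    obtain ⟨Bl, hBl⟩ : ∃ Bl : Finset ℝ, Bl = B.filter (· < p 0) := ⟨_, rfl⟩
    obtain ⟨Br, hBr⟩ : ∃ Br : Finset ℝ, Br = B.filter (fun w => p 0 < w) := ⟨_, rfl⟩
    have hmBl : ∀ w, w ∈ Bl ↔ w ∈ B ∧ w < p 0 := fun w => by rw [hBl, Finset.mem_filter]
    have hmBr : ∀ w, w ∈ Br ↔ w ∈ B ∧ p 0 < w := fun w => by rw [hBr, Finset.mem_filter]
    have hBl_ne : Bl.Nonempty := ⟨_, (hmBl _).2 ⟨B.min'_mem hBne, hlo'⟩⟩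
    have hBr_ne : Br.Nonempty := ⟨_, (hmBr _).2 ⟨B.max'_mem hBne, hhi'⟩⟩
    obtain ⟨huB, hu⟩ := (hmBl _).1 (Bl.max'_mem hBl_ne)
    obtain ⟨hvB, hv⟩ := (hmBr _).1 (Br.min'_mem hBr_ne)
    have hqS : (Bl.max' hBl_ne, Br.min' hBr_ne) ∈ S := by
      refine (hmemS _).2 ⟨⟨huB, hvB⟩, hu.trans hv, fun w hw => ?_⟩
      rcases lt_or_gt_of_ne (fun h : w = p 0 => hpB (h ▸ hw)) with h | h
      · exact Or.inl (Bl.le_max' w ((hmBl w).2 ⟨hw, h⟩))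
      · exact Or.inr (Br.min'_le w ((hmBr w).2 ⟨hw, h⟩))
    refine hpU (mem_iUnion₂.2 ⟨⟨_, hqS⟩, Finset.mem_univ _, ?_⟩)
    rw [hRdom]
    exact ⟨hpP, hu, hv⟩
  have hdisjS : ((Finset.univ : Finset S) : Set S).Pairwise
      (fun q q' => volume ((R q).domain ∩ (R q').domain) = 0) := by
    intro q _ q' _ hne
    refine measure_mono_null (t := ∅) ?_ measure_empty
    rintro p ⟨hp, hp'⟩
    rw [hRdom] at hp hp'
    obtain ⟨-, h1, h2⟩ := hp
    obtain ⟨-, h1', h2'⟩ := hp'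
    obtain ⟨⟨huB, hvB⟩, -, hgap⟩ := (hmemS q.1).1 q.2
    obtain ⟨⟨huB', hvB'⟩, -, hgap'⟩ := (hmemS q'.1).1 q'.2
    refine hne (Subtype.ext (Prod.ext (le_antisymm ?_ ?_) (le_antisymm ?_ ?_)))
    · rcases hgap' _ huB with h | h
      · exact h
      · exact absurd (h1.trans h2') (not_lt.2 h)
    · rcases hgap _ huB' with h | h
      · exact h
      · exact absurd (h1'.trans h2) (not_lt.2 h)
    · rcases hgap _ hvB' with h | h
      · exact absurd (h1.trans h2') (not_lt.2 h)
      · exact h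
    · rcases hgap' _ hvB with h | h
      · exact absurd (h1'.trans h2) (not_lt.2 h)
      · exact h
  have hsum : KZ.of r - ∑ q, KZ.of (R q) ∈ KZ.relations := by
    refine KZ.of_sub_sum_of_mem_relations Finset.univ r R (fun q _ => ?_) (fun q _ => ?_) hcov
      hdisjS
    · rw [hRdom, hrdom]
      exact measure_mono_null (t := ∅) (fun p hp => (hp.2 hp.1.1).elim) measure_empty
    · rw [hRint]
      exact fun _ _ => rfl
  /- (7) each strip is empty, one V-piece, or the difference of two V-pieces -/
  have hstrip : ∀ q : S, ∃ (m : ℕ) (α β a₁ c₁ : Fin m → ℝ) (s : Fin m → ℤ)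
      (W : Fin m → KZ.IntegralRep 2),
      (∀ j, IsAlgebraic ℚ (α j) ∧ IsAlgebraic ℚ (β j) ∧ IsAlgebraic ℚ (a₁ j) ∧
        IsAlgebraic ℚ (c₁ j) ∧ α j < β j ∧ (α j - a₁ j) ^ 2 ≤ c₁ j ∧ (β j - a₁ j) ^ 2 ≤ c₁ j) ∧
      (∀ j, (W j).domain = V (α j) (β j) (a₁ j) (c₁ j) ∧
        (W j).integrand = fun p => 1 / p 1 ^ 2) ∧
      KZ.of (R q) - ∑ j, s j • KZ.of (W j) ∈ KZ.relations := by
    intro q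
    obtain ⟨⟨huB, hvB⟩, hlt, hgap⟩ := (hmemS q.1).1 q.2
    have hJB : ∀ x ∈ Ioo q.1.1 q.1.2, x ∉ B := fun x hx hxB => by
      rcases hgap x hxB with h | h
      · exact absurd hx.1 (not_lt.2 h)
      · exact absurd hx.2 (not_lt.2 h)
    rcases hS' (Ioo q.1.1 q.1.2) ⟨_, _, Or.inl rfl⟩ isPreconnected_Ioo hJB with
      hE | ⟨u, v, i, hJ, -, -, hu, hv, hEq⟩ |
        ⟨u, v, i, j, hJ, -, -, -, -, hui, hvi, huj, hvj, hle, hEq⟩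
    · -- an empty strip
      have h0 : KZ.of (R q) ∈ KZ.relations :=
        KZ.of_mem_relations_of_volume_eq_zero _ (by rw [hRdom, hE, measure_empty])
      exact ⟨0, ![], ![], ![], ![], ![], ![], fun j => j.elim0, fun j => j.elim0,
        by simpa using h0⟩
    · -- one V-piece
      obtain ⟨rfl, rfl⟩ := vcut_Ioo_eq_Ioo hlt hJ
      obtain ⟨W, hWd, hWi⟩ :=
        hRep _ _ (a' i) (c i) (hBalg _ huB) (hBalg _ hvB) (ha' i) (hc i) hlt hu hv
      have h1 : KZ.of (R q) - KZ.of W ∈ KZ.relations := by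
        refine KZ.of_sub_of_mem_relations_of_eqOn ?_ fun p hp => ?_
        · rw [hWd, hV, hRdom, hEq]
        · rw [hRdom] at hp
          rw [hRint, hWi]
          exact hrint hp.1
      refine ⟨1, ![q.1.1], ![q.1.2], ![a' i], ![c i], ![1], ![W], fun l => ?_, fun l => ?_,
        ?_⟩
      · fin_cases l
        exact ⟨hBalg _ huB, hBalg _ hvB, ha' i, hc i, hlt, hu, hv⟩
      · fin_cases l
        exact ⟨hWd, hWi⟩
      · simpa using h1
    · -- the region between two semicircles: `[V_i] = [R q] + [V_j]` up to the null arc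
      obtain ⟨rfl, rfl⟩ := vcut_Ioo_eq_Ioo hlt hJ
      obtain ⟨Wi, hWid, hWii⟩ :=
        hRep _ _ (a' i) (c i) (hBalg _ huB) (hBalg _ hvB) (ha' i) (hc i) hlt hui hvi
      obtain ⟨Wj, hWjd, hWji⟩ :=
        hRep _ _ (a' j) (c j) (hBalg _ huB) (hBalg _ hvB) (ha' j) (hc j) hlt huj hvj
      have h2 : KZ.of Wi - KZ.of (R q) - KZ.of Wj ∈ KZ.relations := by
        refine vcut_two_piece Wi (R q) Wj ?_ ?_ ?_ ?_ ?_ ?_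
        · rw [hRdom, hEq, hWid, hV]
          exact fun p hp => ⟨hp.1, hp.2.1, hp.2.2.1, hp.2.2.2.1⟩
        · rw [hWjd, hWid, hV, hV]
          rintro p ⟨h1, h2, h3, h4⟩
          exact ⟨h1, h2, h3, by linarith [hle (p 0) ⟨h1, h2⟩]⟩
        · refine measure_mono_null ?_ (vcut_volume_arc (a' j) (c j))
          rw [hRdom, hEq, hWid, hWjd, hV, hV]
          rintro p ⟨⟨h1, h2, h3, h4⟩, hp⟩
          refine ⟨h3, le_antisymm (not_lt.1 fun h => hp (Or.inr ⟨h1, h2, h3, h⟩))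
            (not_lt.1 fun h => hp (Or.inl ⟨h1, h2, h3, h4, h⟩))⟩
        · refine measure_mono_null (t := ∅) ?_ measure_empty
          rw [hRdom, hEq, hWjd, hV]
          rintro p ⟨⟨-, -, -, -, h5⟩, -, -, -, h6⟩
          exact (lt_irrefl _ (h5.trans h6)).elim
        · intro p hp
          rw [hRdom] at hp
          rw [hWii, hRint]
          exact (hrint hp.1).symm
        · intro p _
          rw [hWii, hWji]
      have h2' : KZ.of (R q) - (KZ.of Wi - KZ.of Wj) ∈ KZ.relations := by
        have h3 := neg_mem h2
        convert h3 using 1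
        abel
      refine ⟨2, ![q.1.1, q.1.1], ![q.1.2, q.1.2], ![a' i, a' j], ![c i, c j], ![1, -1],
        ![Wi, Wj], fun l => ?_, fun l => ?_, ?_⟩
      · fin_cases l
        · exact ⟨hBalg _ huB, hBalg _ hvB, ha' i, hc i, hlt, hui, hvi⟩
        · exact ⟨hBalg _ huB, hBalg _ hvB, ha' j, hc j, hlt, huj, hvj⟩
      · fin_cases l
        · exact ⟨hWid, hWii⟩
        · exact ⟨hWjd, hWji⟩
      · rw [Fin.sum_univ_two]
        convert h2' using 2
        simp only [Matrix.cons_val_zero, Matrix.cons_val_one, one_smul, neg_smul]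
        abel
  /- (8) assemble -/
  choose m α β a₁ c₁ s W hdata hW hrel using hstrip
  refine vcut_flatten V (KZ.of r) (ι := Σ q : S, Fin (m q)) (fun l => α l.1 l.2)
    (fun l => β l.1 l.2) (fun l => a₁ l.1 l.2) (fun l => c₁ l.1 l.2) (fun l => s l.1 l.2)
    (fun l => W l.1 l.2)
    (fun l => hdata l.1 l.2) (fun l => hW l.1 l.2) ?_
  have hsigma : ∑ l : (Σ q : S, Fin (m q)), s l.1 l.2 • KZ.of (W l.1 l.2) =
      ∑ q, ∑ j, s q j • KZ.of (W q j) := by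
    rw [Fintype.sum_sigma]
  have hC : ∑ q, KZ.of (R q) - ∑ q, ∑ j, s q j • KZ.of (W q j) ∈ KZ.relations := by
    rw [← Finset.sum_sub_distrib]
    exact sum_mem fun q _ => hrel q
  have hfin := add_mem hsum hC
  rwa [sub_add_sub_cancel, ← hsigma] at hfin

end Summit.KontsevichZagierPeriods.HyperbolicBloch.OffTetraSectorKernel

end
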